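import Literature.NumberTheory.Transcendental.SixExponentials
import HarnessLib

/-!
# The six exponentials theorem: extrapolation, contradiction, `six_exponentials_holds`

Topic `Literature/NumberTheory/Transcendental` (trunk T-TRANSCEND), family `periods`. Sibling
proof file of `PeriodsWave0.lean` / `SixExponentials.lean`: it DISCHARGES the named fact
`Literature.NumberTheory.Transcendental.six_exponentials` (**periods.S14**; Siegel, Lang 1966, Ch. II §1 Thm. 1, Ramachandra
1968) as `Literature.NumberTheory.Transcendental.six_exponentials_holds`, from the set-up of `SixExponentials.lean`.

## Proof (Schneider's method; Waldschmidt 2009, §3.1.5, as in `SixExponentialsRat.lean`)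

Let `S : SixExp.Setup` be a would-be counterexample, `K = ℚ(e^{xᵢyⱼ})`, `h = [K:ℚ]`,
`C₀ = |d| M`, `C_K` Siegel's constant of `K`, `X = ∑|xᵢ|`, `Y = ∑|yⱼ|`,
`κ₀ = 4 + 2 log C_K + 18 log C₀ + 5XY`, `κ = (h+1)κ₀`, `u = ⌈2κ⌉₊ + 1`, `L = 4u³`, `S₀ = 2u²`.
* Siegel's lemma (`Setup.exists_solution`) gives `p ≠ 0` in `𝓞 K^{L²}` with `F = ∑ p(λ)e^{w(λ)t}`
  vanishing on the box `[0,S₀)³` and `house p(λ) ≤ P`.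
* *Extrapolation* `T → T+1` (`T ≥ S₀`, `Setup.elim`): if `F` vanishes on `[0,T)³` (`T³` distinct
  points of modulus `≤ TY`) and `k ∈ [0,T]³`, the Schwarz lemma on `|t| = 5TY`
  (`SixExpRat.norm_le_of_forall_eq_zero`) gives `|F(z(k))| ≤ θ 2^{-T³}`, `θ = L² P e^{5LXTY}`;
  on the other hand `ξ = (M_{T+1} p)(k) = D_{T+1} F(z(k)) ∈ 𝓞 K` has all its conjugates
  `≤ B = L² C₀^{6L(T+1)} P`, so if `ξ ≠ 0` the Liouville inequality
  (`AlgGens.norm_ge_of_forall_norm_le`) gives `|ξ| ≥ B^{-(h-1)}`, whence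
  `2^{T³} ≤ B^{h-1} C₀^{6L(T+1)} θ ≤ W^{h+1}` with `W = L² P C₀^{6L(T+1)} e^{5LXTY} ≤ e^{LTκ₀}`
  (`W_le`), i.e. `T³ log 2 ≤ (h+1) L T κ₀ = 4u³Tκ ≤ T³/2` (`param_ineq`), absurd
  (`exp_half_cube_lt_two_pow`). Hence `F(z(k)) = 0`.
* *Conclusion.* `F` vanishes on the whole lattice `ℕ³`, so `p = 0` by Artin's theorem
  (`Setup.eq_zero_of_forall_F_eq_zero`), contradicting `p ≠ 0`.

## References

* [Lang1966] S. Lang, *Introduction to transcendental numbers*, Addison-Wesley, 1966, Ch. II §1,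
  Thm. 1.
* [Ramachandra1968] K. Ramachandra, Acta Arith. 14 (1967/68), 65–72, 73–88.
* [Waldschmidt2008EllipticSurvey] M. Waldschmidt, in Surveys in Number Theory, Dev. Math. 17
  (2008), Thm. 10, PDF pp. 128–129.
* [Waldschmidt2009] M. Waldschmidt, Ramanujan J. 20 (2009) = arXiv:0908.4024, §3.1.5.
-/

noncomputable section

open Complex Finset Metric NumberField

namespace Literature.NumberTheory.Transcendental

namespace SixExp

/-! ### Numerical lemmas -/

/-- `exp(T³/2) < 2^{T³}` for `T ≠ 0`. [folklore] -/
theorem exp_half_cube_lt_two_pow {T : ℕ} (hT : T ≠ 0) :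
    Real.exp ((T : ℝ) ^ 3 / 2) < (2 : ℝ) ^ (T ^ 3) := by
  have he : Real.exp (1 / 2 : ℝ) < 2 := by
    have h1 := Real.exp_one_lt_d9
    have hsq : Real.exp (1 / 2 : ℝ) ^ 2 = Real.exp 1 := by
      rw [← Real.exp_nat_mul]; norm_num
    nlinarith [Real.exp_pos (1 / 2 : ℝ)]
  have hT3 : T ^ 3 ≠ 0 := pow_ne_zero 3 hT
  calc Real.exp ((T : ℝ) ^ 3 / 2) = Real.exp (1 / 2) ^ (T ^ 3) := by
        rw [← Real.exp_nat_mul]; congr 1; push_cast; ring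
    _ < 2 ^ (T ^ 3) := pow_lt_pow_left₀ he (Real.exp_pos _).le hT3

/-- The choice of parameters: with `L = 4u³`, `T ≥ 2u²` and `u ≥ 2κ ≥ 0` one has
`L T κ ≤ T³/2`. [folklore] -/
theorem param_ineq {κ u T : ℝ} (hκ : 0 ≤ κ) (hκu : 2 * κ ≤ u) (hT : 2 * u ^ 2 ≤ T) :
    4 * u ^ 3 * T * κ ≤ T ^ 3 / 2 := by
  have hu : 0 ≤ u := by linarith
  have hT0 : 0 ≤ T := le_trans (by positivity) hT
  have h1 : 4 * u ^ 3 * T * κ ≤ 2 * u ^ 4 * T := by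
    have : 4 * u ^ 3 * T * (2 * κ) ≤ 4 * u ^ 3 * T * u :=
      mul_le_mul_of_nonneg_left hκu (by positivity)
    nlinarith
  have h2 : (2 * u ^ 2) ^ 2 * T ≤ T ^ 2 * T :=
    mul_le_mul_of_nonneg_right (pow_le_pow_left₀ (by positivity) hT 2) hT0
  nlinarith

/-- The growth bookkeeping: with `ℓ = log C₀`, `ℓ_K = log C_K`,
`W = L² · C_K (C_K L² C₀^{6LS₀}) · C₀^{6L(T+1)} · e^{5LXTY} ≤ exp(L T (4 + 2ℓ_K + 18ℓ + 5XY))`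
for `1 ≤ S₀ ≤ T`, `1 ≤ L`. [folklore] -/
theorem W_le {L T S₀ : ℕ} (hL : 1 ≤ L) (hS₀ : 1 ≤ S₀) (hS₀T : S₀ ≤ T) {C₀ CK X Y : ℝ}
    (hC₀ : 1 ≤ C₀) (hCK : 1 ≤ CK) :
    (L : ℝ) ^ 2 * (CK * (CK * ((L ^ 2 : ℕ) : ℝ) * C₀ ^ (6 * (L * S₀)))) * C₀ ^ (6 * (L * (T + 1))) *
        Real.exp (L * X * (5 * (T * Y))) ≤
      Real.exp (L * T * (4 + 2 * Real.log CK + 18 * Real.log C₀ + 5 * X * Y)) := by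
  set ℓ : ℝ := Real.log C₀ with hℓdef
  set ℓK : ℝ := Real.log CK with hℓKdef
  have hℓ : 0 ≤ ℓ := Real.log_nonneg hC₀
  have hℓK : 0 ≤ ℓK := Real.log_nonneg hCK
  have hC₀pow : ∀ n : ℕ, C₀ ^ n = Real.exp (n * ℓ) := fun n => by
    rw [Real.exp_nat_mul, Real.exp_log (by positivity)]
  have hCKexp : CK = Real.exp ℓK := (Real.exp_log (by positivity)).symm
  have hLr : (1 : ℝ) ≤ L := by exact_mod_cast hL
  have hTr : (1 : ℝ) ≤ T := by exact_mod_cast hS₀.trans hS₀T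
  have hS₀Tr : (S₀ : ℝ) ≤ T := by exact_mod_cast hS₀T
  have hL4 : (L : ℝ) ^ 2 * ((L ^ 2 : ℕ) : ℝ) ≤ Real.exp (4 * L) := by
    have h1 : (L : ℝ) ≤ Real.exp L := by linarith [Real.add_one_le_exp (L : ℝ)]
    calc (L : ℝ) ^ 2 * ((L ^ 2 : ℕ) : ℝ) = (L : ℝ) ^ 4 := by push_cast; ring
      _ ≤ Real.exp L ^ 4 := pow_le_pow_left₀ (by positivity) h1 4
      _ = Real.exp (4 * L) := by rw [← Real.exp_nat_mul]; norm_num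
  -- rewrite the left-hand side as `L⁴ · exp(…)`
  have hlhs : (L : ℝ) ^ 2 * (CK * (CK * ((L ^ 2 : ℕ) : ℝ) * C₀ ^ (6 * (L * S₀)))) *
      C₀ ^ (6 * (L * (T + 1))) * Real.exp (L * X * (5 * (T * Y))) =
      (L : ℝ) ^ 2 * ((L ^ 2 : ℕ) : ℝ) * Real.exp (2 * ℓK + ((6 * (L * S₀) : ℕ) : ℝ) * ℓ +
        ((6 * (L * (T + 1)) : ℕ) : ℝ) * ℓ + L * X * (5 * (T * Y))) := by
    rw [hC₀pow, hC₀pow, hCKexp, Real.exp_add, Real.exp_add, Real.exp_add, two_mul, Real.exp_add]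
    ring
  rw [hlhs]
  calc (L : ℝ) ^ 2 * ((L ^ 2 : ℕ) : ℝ) * Real.exp (2 * ℓK + ((6 * (L * S₀) : ℕ) : ℝ) * ℓ +
        ((6 * (L * (T + 1)) : ℕ) : ℝ) * ℓ + L * X * (5 * (T * Y)))
      ≤ Real.exp (4 * L) * Real.exp (2 * ℓK + ((6 * (L * S₀) : ℕ) : ℝ) * ℓ +
        ((6 * (L * (T + 1)) : ℕ) : ℝ) * ℓ + L * X * (5 * (T * Y))) :=
        mul_le_mul_of_nonneg_right hL4 (Real.exp_pos _).le
    _ = Real.exp (4 * L + (2 * ℓK + ((6 * (L * S₀) : ℕ) : ℝ) * ℓ +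
        ((6 * (L * (T + 1)) : ℕ) : ℝ) * ℓ + L * X * (5 * (T * Y)))) := by rw [← Real.exp_add]
    _ ≤ Real.exp (L * T * (4 + 2 * ℓK + 18 * ℓ + 5 * X * Y)) := by
        refine Real.exp_le_exp.2 ?_
        push_cast
        have h1 : (4 : ℝ) * L ≤ 4 * (L * T) := by nlinarith
        have h2 : 2 * ℓK ≤ 2 * ℓK * (L * T) := by
          have : (1 : ℝ) ≤ L * T := by nlinarith
          nlinarith
        have h3 : (6 : ℝ) * (L * S₀) * ℓ ≤ 6 * (L * T) * ℓ := by
          have : (L : ℝ) * S₀ ≤ L * T := mul_le_mul_of_nonneg_left hS₀Tr (by positivity)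
          nlinarith
        have h4 : (6 : ℝ) * (L * (T + 1)) * ℓ ≤ 12 * (L * T) * ℓ := by
          have : (L : ℝ) * (T + 1) ≤ 2 * (L * T) := by nlinarith
          nlinarith
        nlinarith [h1, h2, h3, h4]

namespace Setup

/-- **The contradiction** (Lang 1966, Ch. II §1, Thm. 1; Ramachandra 1968; Waldschmidt 2009,
§3.1.5: "The induction shows that `F` vanishes at more points of this form, until one deduces
that `F` vanishes at all such points, and the conclusion then easily follows"): no `Setup`
exists. [cite: Lang1966, Ch. II §1 Thm. 1] -/
theorem elim (S : Setup) : False := by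
  classical
  -- the constants
  have hX := S.X_nonneg
  have hY := S.Y_pos
  have hC₀ : (1 : ℝ) ≤ S.C₀ := S.one_le_C₀
  have hCK : (1 : ℝ) ≤ siegelConst S.K := one_le_siegelConst S.K
  set κ₀ : ℝ := 4 + 2 * Real.log (siegelConst S.K) + 18 * Real.log S.C₀ + 5 * S.X * S.Y with hκ₀def
  have hκ₀ : 0 ≤ κ₀ := by
    have := Real.log_nonneg hC₀
    have := Real.log_nonneg hCK
    positivity
  set h : ℕ := S.G.h with hhdef
  have hh1 : 1 ≤ h := S.G.one_le_h
  set κ : ℝ := (h + 1) * κ₀ with hκdef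
  have hκ : 0 ≤ κ := by positivity
  set u : ℕ := ⌈2 * κ⌉₊ + 1 with hudef
  have hu1 : 1 ≤ u := by omega
  have hκu : 2 * κ ≤ u := by
    calc 2 * κ ≤ ⌈2 * κ⌉₊ := Nat.le_ceil (2 * κ)
      _ ≤ u := by rw [hudef]; push_cast; linarith
  -- Siegel's lemma at the base level
  obtain ⟨L, hLdef⟩ : ∃ L : ℕ, L = 4 * u ^ 3 := ⟨_, rfl⟩
  obtain ⟨S₀, hS₀def⟩ : ∃ S₀ : ℕ, S₀ = 2 * u ^ 2 := ⟨_, rfl⟩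
  obtain ⟨p, hp0, hMp, hhouse⟩ := S.exists_solution u hu1 hLdef hS₀def
  have hS₀pos : 0 < S₀ := by rw [hS₀def]; positivity
  have hL1 : 1 ≤ L := by rw [hLdef]; have := pow_pos (show 0 < u by omega) 3; omega
  have hP1 : 1 ≤ S.P L S₀ := S.one_le_P hL1 S₀
  -- `F` vanishes on the boxes `k_j < T` for every `T ≥ S₀`
  have hP : ∀ T : ℕ, S₀ ≤ T → ∀ k : Fin 3 → ℕ, (∀ j, k j < T) → S.F L p (S.z k) = 0 := by
    intro T hT
    induction T, hT using Nat.le_induction with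
    | base =>
      intro k hk
      have e : S.D L S₀ * S.F L p (S.z k) =
          ((((S.M L S₀).mulVec p (fun j => ⟨k j, hk j⟩) : 𝓞 S.K) : S.K) : ℂ) :=
        S.D_mul_F L S₀ p (fun j => ⟨k j, hk j⟩)
      rw [hMp, Pi.zero_apply, S.coe_coe_zero] at e
      exact (mul_eq_zero.1 e).resolve_left (S.D_ne_zero L S₀)
    | succ T hST ih =>
      intro k hk
      by_contra hne
      have hT1 : 1 ≤ T := le_trans hS₀pos hST
      -- the zeros already known: the box of side `T`, `T³` distinct points of modulus `≤ T·Y`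
      set s : Finset ℂ := Finset.univ.image (fun k' : Fin 3 → Fin T => S.z (fun j => (k' j : ℕ)))
        with hsdef
      have hscard : s.card = T ^ 3 := by
        rw [hsdef, Finset.card_image_of_injective, Finset.card_univ]
        · simp
        · intro k₁ k₂ h12
          have := S.z_injective h12
          funext j
          exact Fin.ext (congrFun this j)
      have hR₁ : (0 : ℝ) < T * S.Y := by positivity
      have hs : ∀ c ∈ s, ‖c‖ ≤ T * S.Y := by
        intro c hc
        rw [hsdef, Finset.mem_image] at hc
        obtain ⟨k', -, rfl⟩ := hc
        exact S.norm_z_le _ fun j => (k' j).isLt.le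
      have h0 : ∀ c ∈ s, S.F L p c = 0 := by
        intro c hc
        rw [hsdef, Finset.mem_image] at hc
        obtain ⟨k', -, rfl⟩ := hc
        exact ih _ fun j => (k' j).isLt
      have hw : ‖S.z k‖ ≤ T * S.Y := S.norm_z_le k fun j => Nat.lt_succ_iff.1 (hk j)
      -- the upper bound (Schwarz lemma with `T³` zeros, circle of radius `5·T·Y`)
      set θ : ℝ := (L : ℝ) ^ 2 * S.P L S₀ * Real.exp (L * S.X * (5 * (T * S.Y))) with hθdef
      have hθ : ∀ t ∈ sphere (0 : ℂ) (5 * (T * S.Y)), ‖S.F L p t‖ ≤ θ := by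
        intro t ht
        have ht' : ‖t‖ = 5 * (T * S.Y) := by
          have : dist t 0 = 5 * (T * S.Y) := ht
          simpa using this
        have h := S.norm_F_le L p hhouse t
        rwa [ht'] at h
      have hup : ‖S.F L p (S.z k)‖ ≤ θ / 2 ^ (T ^ 3) := by
        have := SixExpRat.norm_le_of_forall_eq_zero (S.differentiable_F L p) s hR₁ hs h0 hθ hw
        rwa [hscard] at this
      -- the lower bound (Liouville's inequality for the algebraic integer `(M_{T+1} p)(k)`)
      set ξ : 𝓞 S.K := (S.M L (T + 1)).mulVec p (fun j => ⟨k j, hk j⟩) with hξdef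
      have hξ : S.D L (T + 1) * S.F L p (S.z k) = ((ξ : S.K) : ℂ) :=
        S.D_mul_F L (T + 1) p (fun j => ⟨k j, hk j⟩)
      have hξ0 : ξ ≠ 0 := by
        intro h0'
        rw [h0', S.coe_coe_zero] at hξ
        exact hne ((mul_eq_zero.1 hξ).resolve_left (S.D_ne_zero L (T + 1)))
      set B : ℝ := (L : ℝ) ^ 2 * (S.C₀ ^ (6 * (L * (T + 1))) * S.P L S₀) with hBdef
      have hB1 : 1 ≤ B := by
        have hL2 : (1 : ℝ) ≤ (L : ℝ) ^ 2 := one_le_pow₀ (by exact_mod_cast hL1)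
        exact one_le_mul_of_one_le_of_one_le hL2
          (one_le_mul_of_one_le_of_one_le (one_le_pow₀ hC₀) hP1)
      have hconj : ∀ σ : S.K →+* ℂ, ‖σ (ξ : S.K)‖ ≤ B := fun σ =>
        S.norm_embedding_mulVec_le L (T + 1) p hhouse _ σ
      have hlow : (B ^ (h - 1))⁻¹ ≤ ‖((ξ : S.K) : ℂ)‖ := S.G.norm_ge_of_forall_norm_le hξ0 hB1 hconj
      -- combine: `2^{T³} ≤ B^{h-1} · C₀^{6L(T+1)} · θ`
      have hcomb : (2 : ℝ) ^ (T ^ 3) ≤ B ^ (h - 1) * (S.C₀ ^ (6 * (L * (T + 1))) * θ) := by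
        have hBpos : 0 < B ^ (h - 1) := by positivity
        have h2 : (0 : ℝ) < 2 ^ (T ^ 3) := by positivity
        have h1 : (B ^ (h - 1))⁻¹ ≤ S.C₀ ^ (6 * (L * (T + 1))) * (θ / 2 ^ (T ^ 3)) :=
          calc (B ^ (h - 1))⁻¹ ≤ ‖((ξ : S.K) : ℂ)‖ := hlow
            _ = ‖S.D L (T + 1) * S.F L p (S.z k)‖ := by rw [hξ]
            _ ≤ S.C₀ ^ (6 * (L * (T + 1))) * ‖S.F L p (S.z k)‖ := S.norm_D_mul_le L (T + 1) _
            _ ≤ S.C₀ ^ (6 * (L * (T + 1))) * (θ / 2 ^ (T ^ 3)) :=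
                mul_le_mul_of_nonneg_left hup (by positivity)
        rw [inv_le_iff_one_le_mul₀' hBpos, ← mul_div_assoc, ← mul_div_assoc,
          le_div_iff₀ h2, one_mul] at h1
        exact h1
      -- every factor is at most `W ≤ exp(L T κ₀)`
      set W : ℝ := (L : ℝ) ^ 2 * S.P L S₀ * S.C₀ ^ (6 * (L * (T + 1))) *
        Real.exp (L * S.X * (5 * (T * S.Y))) with hWdef
      have hE1 : 1 ≤ Real.exp (L * S.X * (5 * (T * S.Y))) := Real.one_le_exp (by positivity)
      have hCpow1 : 1 ≤ S.C₀ ^ (6 * (L * (T + 1))) := one_le_pow₀ hC₀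
      have hL2P : 1 ≤ (L : ℝ) ^ 2 * S.P L S₀ :=
        one_le_mul_of_one_le_of_one_le (one_le_pow₀ (by exact_mod_cast hL1)) hP1
      have hθW : θ ≤ W := by
        rw [hθdef, hWdef]
        have : (L : ℝ) ^ 2 * S.P L S₀ * Real.exp (L * S.X * (5 * (T * S.Y))) =
            (L : ℝ) ^ 2 * S.P L S₀ * 1 * Real.exp (L * S.X * (5 * (T * S.Y))) := by ring
        rw [this]
        gcongr
      have hBW : B ≤ W := by
        rw [hBdef, hWdef]
        have : (L : ℝ) ^ 2 * (S.C₀ ^ (6 * (L * (T + 1))) * S.P L S₀) =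
            (L : ℝ) ^ 2 * S.P L S₀ * S.C₀ ^ (6 * (L * (T + 1))) * 1 := by ring
        rw [this]
        exact mul_le_mul_of_nonneg_left hE1 (by positivity)
      have hCW : S.C₀ ^ (6 * (L * (T + 1))) ≤ W := by
        rw [hWdef]
        calc S.C₀ ^ (6 * (L * (T + 1))) = 1 * S.C₀ ^ (6 * (L * (T + 1))) * 1 := by ring
          _ ≤ (L : ℝ) ^ 2 * S.P L S₀ * S.C₀ ^ (6 * (L * (T + 1))) *
              Real.exp (L * S.X * (5 * (T * S.Y))) :=
            mul_le_mul (mul_le_mul_of_nonneg_right hL2P (by positivity)) hE1 zero_le_one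
              (by positivity)
      have hW0 : 0 ≤ W := by positivity
      have hprod : B ^ (h - 1) * (S.C₀ ^ (6 * (L * (T + 1))) * θ) ≤ W ^ (h + 1) := by
        have e : W ^ (h + 1) = W ^ (h - 1) * (W * W) := by
          conv_lhs => rw [show h + 1 = (h - 1) + 2 by omega]
          ring
        rw [e]
        have hθ0 : 0 ≤ θ := by positivity
        exact mul_le_mul (pow_le_pow_left₀ (by positivity) hBW _)
          (mul_le_mul hCW hθW hθ0 hW0) (by positivity) (by positivity)
      have hWexp : W ≤ Real.exp (L * T * κ₀) := by
        have := W_le (T := T) hL1 hS₀pos hST hC₀ hCK (C₀ := S.C₀) (CK := siegelConst S.K)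
          (X := S.X) (Y := S.Y)
        rw [hWdef, P]
        convert this using 2
      -- the numerical contradiction
      have hfin : (2 : ℝ) ^ (T ^ 3) ≤ Real.exp ((T : ℝ) ^ 3 / 2) :=
        calc (2 : ℝ) ^ (T ^ 3) ≤ W ^ (h + 1) := hcomb.trans hprod
          _ ≤ Real.exp (L * T * κ₀) ^ (h + 1) := pow_le_pow_left₀ hW0 hWexp _
          _ = Real.exp ((h + 1 : ℕ) * (L * T * κ₀)) := by rw [← Real.exp_nat_mul]
          _ ≤ Real.exp ((T : ℝ) ^ 3 / 2) := by
              refine Real.exp_le_exp.2 ?_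
              have hTr : (2 : ℝ) * (u : ℝ) ^ 2 ≤ T := by
                have : ((2 * u ^ 2 : ℕ) : ℝ) ≤ T := by rw [← hS₀def]; exact_mod_cast hST
                push_cast at this
                exact this
              have hLr : (L : ℝ) = 4 * (u : ℝ) ^ 3 := by rw [hLdef]; push_cast; ring
              have key := param_ineq hκ hκu hTr
              calc ((h + 1 : ℕ) : ℝ) * (L * T * κ₀) = 4 * (u : ℝ) ^ 3 * T * κ := by
                    rw [hLr, hκdef]; push_cast; ring
                _ ≤ (T : ℝ) ^ 3 / 2 := key
      exact absurd (exp_half_cube_lt_two_pow (T := T) (by omega)) (not_lt.2 hfin)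
  -- hence `F` vanishes at every lattice point, and Artin's theorem kills the coefficients
  have hall : ∀ k : Fin 3 → ℕ, S.F L p (S.z k) = 0 := fun k =>
    hP (max S₀ (Finset.univ.sup k + 1)) (le_max_left _ _) k fun j =>
      lt_max_of_lt_right (Nat.lt_succ_of_le (Finset.le_sup (Finset.mem_univ j)))
  exact hp0 (S.eq_zero_of_forall_F_eq_zero L p hall)

end Setup

end SixExp

/-! ### The theorem -/

/-- **The six exponentials theorem** (Siegel, unpublished; Lang 1966, Ch. II §1, Thm. 1;
Ramachandra 1968; Waldschmidt 2008, Thm. 10; Waldschmidt 2009, §3.1.5): the named fact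
`six_exponentials` (**periods.S14**) holds — if `x₁, x₂ ∈ ℂ` are `ℚ`-linearly independent and
`y₁, y₂, y₃ ∈ ℂ` are `ℚ`-linearly independent, then at least one of the six numbers `e^{xᵢ yⱼ}`
is transcendental. Proof: a counterexample would be a `SixExp.Setup`, which `SixExp.Setup.elim`
rules out. [cite: Lang1966, Ch. II §1 Thm. 1] -/
theorem six_exponentials_holds : six_exponentials := by
  intro x y hx hy
  by_contra hne
  simp only [not_exists, Transcendental, not_not] at hne
  exact (SixExp.Setup.mk x y hx hy hne).elim

end Literature.NumberTheory.Transcendental
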